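import Summits.AnomalousDissipation.AnomalousDissipation.Theorems.SolenoidalFractalHomogenisationLagrangianStepVmodLossDuality
import Summits.AnomalousDissipation.AnomalousDissipation.Theorems.SolenoidalFractalHomogenisationLagrangianStepVmodFrameDefsJE
import Literature.Analysis.FluidPDE.PassiveVectorTensorDistortedTwistedCoercivity
import Literature.Analysis.FluidPDE.PassiveVectorTensorDistortedTransverseInvariance
import HarnessLib

/-!
# K1L_D (stmt-AnomalousDissipation-27980), (ℓ3-A) road A, (S2-adj) glue: the ADJOINT LOSS of a distorted propagator in VARIATIONAL form —
# `EnergyIdGAdj` + the (S2-core) duality ⇒ `lossAdj (U s t₀) ζ ≥ 2∫ (λ·A_σ(χ) − λ²·Q_σ(χ))` for every smooth dual field `χ` and every `λ`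
(helper; `--supports 27980 --as helper`; prover ad-k1loc-p3 g12; successor step of p728110 `EnergyIdGAdj` and p729091 `integral_quadForm_ge_duality`
named in the g11 FINAL HANDOFF as the (S2-adj) recipe.)

CONVENTION (D28-8′): derivative-index distortion `Torus.Visc4.conj`; constraint `∇·(G v) = 0`.

WHAT.  The binder `hEA : EnergyIdGAdj Tw 𝔹₀ b G U` (p728110) hands, for a window end `t₀` and a `G(t₀)`-solenoidal test `ζ`, an adjoint witness
`(ψ, Dψ)` with `lossAdj (U s t₀) ζ = 2 ∫_{σ ∈ (0,t₀−s]} D(σ)`, `D(σ) = ∫ Σ (𝔹₀ᵀ)^{G(t₀−σ,x)} (Dψ σ) (Dψ σ)` (`EnergyIdGAdj.lossAdj_eq`).  The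
(S2-core) engine (p729091) bounds such a dissipation density from BELOW by any smooth dual field.  This file glues the two and puts the result in the
three forms the (S2-adj) block proofs consume:
* §1 algebra of the quadratic form `Q_𝔸(ξ) = Σ_{l,i,c,e} 𝔸 icle ξ_{ci} ξ_{el}`: it is `Torus.gradForm 𝔸 (ξᵀ)` (`quadForm_eq_gradForm`), invariant under
  `majorTranspose` (`quadForm_majorTranspose`), and conjugation by `M` is the substitution `ξ ↦ ξ·M` (`quadForm_conj_eq`), so FULL nonnegativity of
  `Q_{𝔹₀}` passes to `Q_{𝔹₀ᵀ}` and to every conjugate `Q_{(𝔹₀ᵀ)^{M}}` (`quadForm_conj_nonneg`); smoothness of the conjugated coefficient field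
  (`isSmooth_conj_field`);
* §2 the SCALED duality `λ·A − λ²·Q(χ) ≤ D` (`integral_quadForm_ge_duality_smul`, from p729091 at `λ•χ`) and its optimisation
  `A²/(4Q(χ)) ≤ D` when `0 < Q(χ)` (`integral_quadForm_ge_sq_div`), where `A = −∫⟪u, 𝓛^{𝔹ᵗ,*}χ⟫ − ∫⟪u, 𝓛^{𝔹,*}χ⟫`;
* §3 **`EnergyIdGAdj.exists_witness_duality`**: under `hEA`, smooth frame slices and full nonnegativity of `Q_{𝔹₀}`, the adjoint witness with
  (i) the loss formula for every base time `s ∈ [0,t₀)`, (ii) for a.e. `σ ∈ (0,t₀)`: `ψ σ ∈ L²`, `Dψ σ c ∈ L²`, the weak partial derivatives, and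
  the scaled duality `λ·A_σ(χ) − λ²·Q_σ(χ) ≤ D(σ)` for EVERY smooth `χ` and EVERY real `λ`
  (`A_σ(χ) = −∫⟪ψ σ, 𝓛^{(𝔹₀)^{G(t₀−σ)},*}χ⟫ − ∫⟪ψ σ, 𝓛^{(𝔹₀ᵀ)^{G(t₀−σ)},*}χ⟫`, `Q_σ(χ) = ∫ Σ (𝔹₀ᵀ)^{G(t₀−σ)} ∂χ ∂χ`);
* §4 **`EnergyIdGAdj.lossAdj_ge_two_setIntegral`**: the INTEGRATED consumer form — if `f` is integrable on a final stretch `(0,τ]`, `τ ≤ t₀ − s`, and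
  `f σ ≤ D(σ)` a.e. there, then `2 ∫_{(0,τ]} f ≤ lossAdj (U s t₀) ζ` (uses `D ≥ 0` a.e. and the integrability of `D`, both proved here from the
  `L²` clause of `Dψ` and the joint continuity of `G`).
The choice of `χ` (the corrected slow test, a Leray-corrected image, …), of `λ`, and the control of `A_σ(χ)` as `σ → 0` are the block prover's
business (memo `HOME/ad-k1loc-p3/S2ADJ-NOTE-p3g12.md`).  `sorry`-free; NOT a proof of any block, of K1L_D or of AD; rung F-D1.A0.
-/

set_option linter.dupNamespace false

noncomputable section

namespace Summit.AnomalousDissipation.AnomalousDissipation.Theorems.SolenoidalFractalHomogenisation.LagrangianStep.VmodDist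

open Literature.Analysis Literature.Analysis.FluidPDE Literature.Analysis.FunctionSpaces
open MeasureTheory Set Filter Function
open scoped ENNReal NNReal InnerProductSpace
open Summit.AnomalousDissipation.AnomalousDissipation.Theorems.SolenoidalFractalHomogenisation.LagrangianStep.CellClauseMod
open Summit.AnomalousDissipation.AnomalousDissipation.Theorems.SolenoidalFractalHomogenisation.LagrangianStep.CellEnergyT

/-! ## §1 Algebra of the quadratic form `Q_𝔸(ξ) = Σ 𝔸 icle ξ_{ci} ξ_{el}` -/

/-- Moving the outermost of three finite sums innermost. -/
private theorem sum_rotate₃ {α : Type*} [AddCommMonoid α] (f : Fin 3 → Fin 3 → Fin 3 → α) :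
    ∑ x, ∑ y, ∑ z, f x y z = ∑ y, ∑ z, ∑ x, f x y z := by
  rw [Finset.sum_comm]
  exact Finset.sum_congr rfl fun y _ => Finset.sum_comm

/-- The energy integrand of `EnergyIdG(Adj)` is the tree's energy form on the transposed matrix: `Σ_{l,i,c,e} 𝔸 icle ξ_{ci} ξ_{el} = gradForm 𝔸 (ξᵀ)`. -/
theorem quadForm_eq_gradForm (𝔸 : Torus.Visc4 (Fin 3)) (ξ : Fin 3 → Fin 3 → ℝ) :
    ∑ l, ∑ i, ∑ c, ∑ e, 𝔸 i c l e * ξ c i * ξ e l = Torus.gradForm 𝔸 (fun i c => ξ c i) := by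
  rw [Torus.gradForm_eq_sum_mul_mul, sum_rotate₃]

/-- The quadratic form is invariant under the major transposition: `Q_{𝔸ᵀ}(ξ) = Q_𝔸(ξ)`. -/
theorem quadForm_majorTranspose (𝔸 : Torus.Visc4 (Fin 3)) (ξ : Fin 3 → Fin 3 → ℝ) :
    ∑ l, ∑ i, ∑ c, ∑ e, Torus.majorTranspose 𝔸 i c l e * ξ c i * ξ e l
      = ∑ l, ∑ i, ∑ c, ∑ e, 𝔸 i c l e * ξ c i * ξ e l := by
  simp only [Torus.majorTranspose_apply]
  conv_lhs => rw [Finset.sum_comm]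
  refine Finset.sum_congr rfl fun l _ => Finset.sum_congr rfl fun i _ => ?_
  rw [Finset.sum_comm]
  exact Finset.sum_congr rfl fun c _ => Finset.sum_congr rfl fun e _ => by ring

/-- Conjugation acts on the quadratic form by the substitution `ξ ↦ ξ·M`: `Q_{𝔸^M}(ξ) = Q_𝔸((c,i) ↦ Σ_a M a c ξ_{ai})`. -/
theorem quadForm_conj_eq (M : Matrix (Fin 3) (Fin 3) ℝ) (𝔸 : Torus.Visc4 (Fin 3)) (ξ : Fin 3 → Fin 3 → ℝ) :
    ∑ l, ∑ i, ∑ c, ∑ e, Torus.Visc4.conj M 𝔸 i c l e * ξ c i * ξ e l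
      = ∑ l, ∑ i, ∑ c, ∑ e, 𝔸 i c l e * (∑ a, M a c * ξ a i) * (∑ a, M a e * ξ a l) := by
  rw [quadForm_eq_gradForm, quadForm_eq_gradForm, Torus.gradForm_conj_eq]

/-- **Full nonnegativity of the quadratic form survives transposition and conjugation**: if `Q_𝔸(ξ) ≥ 0` for every matrix `ξ` then
`Q_{(𝔸ᵀ)^M}(ξ) ≥ 0` and `Q_{𝔸^M}(ξ) ≥ 0` for every `M`, `ξ`. -/
theorem quadForm_conj_nonneg {𝔸 : Torus.Visc4 (Fin 3)} (hQ : ∀ ξ : Fin 3 → Fin 3 → ℝ, 0 ≤ ∑ l, ∑ i, ∑ c, ∑ e, 𝔸 i c l e * ξ c i * ξ e l)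
    (M : Matrix (Fin 3) (Fin 3) ℝ) (ξ : Fin 3 → Fin 3 → ℝ) :
    0 ≤ ∑ l, ∑ i, ∑ c, ∑ e, Torus.Visc4.conj M 𝔸 i c l e * ξ c i * ξ e l ∧
    0 ≤ ∑ l, ∑ i, ∑ c, ∑ e, Torus.Visc4.conj M (Torus.majorTranspose 𝔸) i c l e * ξ c i * ξ e l := by
  refine ⟨?_, ?_⟩
  · rw [quadForm_conj_eq]; exact hQ _
  · rw [Torus.Visc4.conj_majorTranspose, quadForm_majorTranspose, quadForm_conj_eq]; exact hQ _

/-- The entries of the conjugated coefficient field `y ↦ 𝔸^{G(y)}` are smooth when the entries of `G` are. -/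
theorem isSmooth_conj_field {Gs : UnitAddTorus (Fin 3) → Matrix (Fin 3) (Fin 3) ℝ} (hG : ∀ i j, Torus.IsSmooth (fun y => Gs y i j))
    (𝔸 : Torus.Visc4 (Fin 3)) (i c l e : Fin 3) : Torus.IsSmooth (fun y => Torus.Visc4.conj (Gs y) 𝔸 i c l e) :=
  Torus.isSmooth_conj_entry hG 𝔸 i c l e

/-! ## §2 The scaled and the optimised duality -/

variable {𝔹 : UnitAddTorus (Fin 3) → Torus.Visc4 (Fin 3)} {u χ : VF} {Du : Fin 3 → VF}

/-- **Scaled duality**: `λ·A − λ²·Q(χ) ≤ D` for every real `λ`, where `A = −∫⟪u, 𝓛^{𝔹ᵗ,*}χ⟫ − ∫⟪u, 𝓛^{𝔹,*}χ⟫`, `Q(χ) = ∫ Σ 𝔹 ∂χ ∂χ`,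
`D = ∫ Σ 𝔹 Du Du` (p729091 at the dual field `λ • χ`). -/
theorem integral_quadForm_ge_duality_smul (h𝔹 : ∀ i c l e, Torus.IsSmooth (fun y => 𝔹 y i c l e))
    (hQ : ∀ y (ξ : Fin 3 → Fin 3 → ℝ), 0 ≤ ∑ l, ∑ i, ∑ c, ∑ e, 𝔹 y i c l e * ξ c i * ξ e l)
    (hu : MemLp u 2 volume) (hDu : ∀ c, MemLp (Du c) 2 volume) (hD : ∀ c, Torus.HasWeakPartialDeriv c u (Du c)) (hχ : Torus.IsSmooth χ)
    (lam : ℝ) :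
    lam * (-(∫ x, ⟪u x, Torus.viscAdjVar (fun y => Torus.majorTranspose (𝔹 y)) χ x⟫_ℝ) - ∫ x, ⟪u x, Torus.viscAdjVar 𝔹 χ x⟫_ℝ)
        - lam ^ 2 * ∫ x, ∑ l, ∑ i, ∑ c, ∑ e, 𝔹 x i c l e * (Torus.partialDeriv c χ x) i * (Torus.partialDeriv e χ x) l
      ≤ ∫ x, ∑ l, ∑ i, ∑ c, ∑ e, 𝔹 x i c l e * (Du c x) i * (Du e x) l := by
  have key := integral_quadForm_ge_duality h𝔹 hQ hu hDu hD (hχ.smul lam)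
  have hχ1 : Torus.IsContDiff 1 χ := hχ.isContDiff (by simp)
  -- the scalar comes out of the test operator, the inner products and the partial derivatives
  have e1 : ∀ (𝔹' : UnitAddTorus (Fin 3) → Torus.Visc4 (Fin 3)) x, Torus.viscAdjVar 𝔹' (lam • χ) x = lam • Torus.viscAdjVar 𝔹' χ x :=
    fun 𝔹' x => Torus.viscAdjVar_const_smul 𝔹' hχ1 lam x
  have e2 : ∀ c x, Torus.partialDeriv c (lam • χ) x = lam • Torus.partialDeriv c χ x := fun c x => by
    rw [Torus.partialDeriv_const_smul hχ1 lam c]; rfl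
  simp only [e1, e2, inner_smul_right, PiLp.smul_apply, smul_eq_mul, integral_const_mul] at key
  have e3 : ∫ x, ∑ l, ∑ i, ∑ c, ∑ e, 𝔹 x i c l e * (lam * (Torus.partialDeriv c χ x) i) * (lam * (Torus.partialDeriv e χ x) l)
      = lam ^ 2 * ∫ x, ∑ l, ∑ i, ∑ c, ∑ e, 𝔹 x i c l e * (Torus.partialDeriv c χ x) i * (Torus.partialDeriv e χ x) l := by
    rw [← integral_const_mul]
    refine integral_congr_ae (Eventually.of_forall fun x => ?_)
    simp only [Finset.mul_sum]
    exact Finset.sum_congr rfl fun l _ => Finset.sum_congr rfl fun i _ => Finset.sum_congr rfl fun c _ =>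
      Finset.sum_congr rfl fun e _ => by ring
  rw [e3] at key
  linarith

/-- **Optimised duality**: `A²/(4·Q(χ)) ≤ D` whenever `0 < Q(χ)` (take `λ = A/(2Q(χ))`). -/
theorem integral_quadForm_ge_sq_div (h𝔹 : ∀ i c l e, Torus.IsSmooth (fun y => 𝔹 y i c l e))
    (hQ : ∀ y (ξ : Fin 3 → Fin 3 → ℝ), 0 ≤ ∑ l, ∑ i, ∑ c, ∑ e, 𝔹 y i c l e * ξ c i * ξ e l)
    (hu : MemLp u 2 volume) (hDu : ∀ c, MemLp (Du c) 2 volume) (hD : ∀ c, Torus.HasWeakPartialDeriv c u (Du c)) (hχ : Torus.IsSmooth χ)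
    (hQpos : 0 < ∫ x, ∑ l, ∑ i, ∑ c, ∑ e, 𝔹 x i c l e * (Torus.partialDeriv c χ x) i * (Torus.partialDeriv e χ x) l) :
    (-(∫ x, ⟪u x, Torus.viscAdjVar (fun y => Torus.majorTranspose (𝔹 y)) χ x⟫_ℝ) - ∫ x, ⟪u x, Torus.viscAdjVar 𝔹 χ x⟫_ℝ) ^ 2
        / (4 * ∫ x, ∑ l, ∑ i, ∑ c, ∑ e, 𝔹 x i c l e * (Torus.partialDeriv c χ x) i * (Torus.partialDeriv e χ x) l)
      ≤ ∫ x, ∑ l, ∑ i, ∑ c, ∑ e, 𝔹 x i c l e * (Du c x) i * (Du e x) l := by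
  set A := -(∫ x, ⟪u x, Torus.viscAdjVar (fun y => Torus.majorTranspose (𝔹 y)) χ x⟫_ℝ) - ∫ x, ⟪u x, Torus.viscAdjVar 𝔹 χ x⟫_ℝ with hA
  set Q := ∫ x, ∑ l, ∑ i, ∑ c, ∑ e, 𝔹 x i c l e * (Torus.partialDeriv c χ x) i * (Torus.partialDeriv e χ x) l with hQd
  have key := integral_quadForm_ge_duality_smul h𝔹 hQ hu hDu hD hχ (A / (2 * Q))
  have e : A / (2 * Q) * A - (A / (2 * Q)) ^ 2 * Q = A ^ 2 / (4 * Q) := by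
    field_simp
    ring
  rw [e] at key
  exact key

/-! ## §3 The adjoint witness of `EnergyIdGAdj` and its variational lower bound -/

/-- Slices of a function which is `L²` on the space–time slab are `L²` for a.e. time.
(adapted from `Literature/Analysis/FluidPDE/NSGaldiVorticityL2.lean`, `ae_memLp_slice_of_memLp_prod`) -/
theorem ae_memLp_two_slice {T : ℝ} {F : ℝ → VF}
    (hF : MemLp (uncurry F) 2 (((volume : Measure ℝ).restrict (Ioo 0 T)).prod volume)) :
    ∀ᵐ τ ∂(volume.restrict (Ioo 0 T)), MemLp (F τ) 2 volume := by
  have hslice : ∀ᵐ τ ∂(volume.restrict (Ioo 0 T)), AEStronglyMeasurable (F τ) volume := hF.1.prodMk_left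
  have hfin := lintegral_rpow_enorm_lt_top_of_eLpNorm_lt_top two_ne_zero ENNReal.ofNat_ne_top hF.2
  rw [lintegral_prod _ (hF.1.enorm.pow_const _)] at hfin
  have hint : AEMeasurable (fun τ => ∫⁻ y, ‖uncurry F (τ, y)‖ₑ ^ (2 : ℝ≥0∞).toReal ∂volume) (volume.restrict (Ioo 0 T)) :=
    (hF.1.enorm.pow_const _).lintegral_prod_right'
  have hfin' : ∀ᵐ τ ∂(volume.restrict (Ioo 0 T)), ∫⁻ y, ‖uncurry F (τ, y)‖ₑ ^ (2 : ℝ≥0∞).toReal ∂volume < ⊤ :=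
    ae_lt_top' hint hfin.ne
  filter_upwards [hslice, hfin'] with τ h1 h2
  exact ⟨h1, (eLpNorm_lt_top_iff_lintegral_rpow_enorm_lt_top two_ne_zero ENNReal.ofNat_ne_top).2 h2⟩

variable {Tw : ℝ} {𝔹₀ : Torus.Visc4 (Fin 3)} {b : ℝ → VF} {G : ℝ → UnitAddTorus (Fin 3) → Matrix (Fin 3) (Fin 3) ℝ}
  {U : ℝ → ℝ → (V2 →L[ℝ] V2)}

/-- **The adjoint witness of `EnergyIdGAdj` with its VARIATIONAL LOWER BOUND.**  Under the binder `hEA : EnergyIdGAdj Tw 𝔹₀ b G U`, smooth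
frame slices and full nonnegativity of the quadratic form of `𝔹₀`: for a window end `0 < t₀ ≤ Tw` and a `G(t₀)`-solenoidal `ζ`, the adjoint
witness `(ψ, Dψ)` (reversed clock `σ = t₀ − r`) satisfies (i) `lossAdj (U s t₀) ζ = 2∫_{(0,t₀−s]} D(σ)` for every base time `s ∈ [0,t₀)`, and
(ii) for a.e. `σ ∈ (0,t₀)`: `ψ σ ∈ L²`, `Dψ σ c ∈ L²`, the weak partial derivatives, and for EVERY smooth dual field `χ` and EVERY real `λ`
`λ·(−∫⟪ψ σ, 𝓛^{𝔹₀^{G(t₀−σ)},*}χ⟫ − ∫⟪ψ σ, 𝓛^{(𝔹₀ᵀ)^{G(t₀−σ)},*}χ⟫) − λ²·∫ Σ (𝔹₀ᵀ)^{G(t₀−σ)} ∂χ ∂χ ≤ D(σ)`,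
`D(σ) = ∫ Σ (𝔹₀ᵀ)^{G(t₀−σ,x)} (Dψ σ) (Dψ σ)`. -/
theorem EnergyIdGAdj.exists_witness_duality (hEA : EnergyIdGAdj Tw 𝔹₀ b G U)
    (hGs : ∀ t i j, Torus.IsSmooth (fun y => G t y i j))
    (hQ : ∀ ξ : Fin 3 → Fin 3 → ℝ, 0 ≤ ∑ l, ∑ i, ∑ c, ∑ e, 𝔹₀ i c l e * ξ c i * ξ e l)
    {t₀ : ℝ} (ht₀ : 0 < t₀) (ht₀T : t₀ ≤ Tw) (ζ : V2) (hζ : Torus.IsWeaklyDivFree (Torus.distort (G t₀) ((ζ : V2) : VF))) :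
    ∃ (ψ : ℝ → VF) (Dψ : ℝ → Fin 3 → VF),
      Torus.IsWeakTensorPassiveVectorDistortedOn 0 t₀ (Torus.majorTranspose 𝔹₀) (revCarrier b t₀) (fun σ => G (t₀ - σ)) ((ζ : V2) : VF) ψ ∧
      (∀ c, MemLp (uncurry (Dψ · c)) 2 (((volume : Measure ℝ).restrict (Ioo 0 t₀)).prod volume)) ∧
      (∀ᵐ σ ∂(volume.restrict (Ioo 0 t₀)), ∀ c, Torus.HasWeakPartialDeriv c (ψ σ) (Dψ σ c)) ∧
      (∀ s ∈ Ico 0 t₀, lossAdj (U s t₀) ζ =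
        2 * ∫ σ in Ioc 0 (t₀ - s), ∫ x, ∑ l, ∑ i, ∑ c, ∑ e,
          Torus.Visc4.conj (G (t₀ - σ) x) (Torus.majorTranspose 𝔹₀) i c l e * (Dψ σ c x) i * (Dψ σ e x) l) ∧
      ∀ᵐ σ ∂(volume.restrict (Ioo 0 t₀)), MemLp (ψ σ) 2 volume ∧ (∀ c, MemLp (Dψ σ c) 2 volume) ∧
        ∀ χ : VF, Torus.IsSmooth χ → ∀ lam : ℝ,
          lam * (-(∫ x, ⟪ψ σ x, Torus.viscAdjVar (fun y => Torus.Visc4.conj (G (t₀ - σ) y) 𝔹₀) χ x⟫_ℝ)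
                  - ∫ x, ⟪ψ σ x, Torus.viscAdjVar (fun y => Torus.Visc4.conj (G (t₀ - σ) y) (Torus.majorTranspose 𝔹₀)) χ x⟫_ℝ)
              - lam ^ 2 * ∫ x, ∑ l, ∑ i, ∑ c, ∑ e, Torus.Visc4.conj (G (t₀ - σ) x) (Torus.majorTranspose 𝔹₀) i c l e
                  * (Torus.partialDeriv c χ x) i * (Torus.partialDeriv e χ x) l
            ≤ ∫ x, ∑ l, ∑ i, ∑ c, ∑ e,
                Torus.Visc4.conj (G (t₀ - σ) x) (Torus.majorTranspose 𝔹₀) i c l e * (Dψ σ c x) i * (Dψ σ e x) l := by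
  obtain ⟨ψ, Dψ, hcl, hM, hD, hE⟩ := hEA t₀ ht₀ ht₀T ζ hζ
  refine ⟨ψ, Dψ, hcl, hM, hD, fun s hs => ?_, ?_⟩
  · unfold lossAdj; rw [hE s hs]; ring
  · have hψ2 := hcl.ae_memLp_two
    have hD2 : ∀ c, ∀ᵐ σ ∂(volume.restrict (Ioo 0 t₀)), MemLp (Dψ σ c) 2 volume := fun c => ae_memLp_two_slice (hM c)
    have hD2' : ∀ᵐ σ ∂(volume.restrict (Ioo 0 t₀)), ∀ c, MemLp (Dψ σ c) 2 volume := ae_all_iff.2 hD2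
    filter_upwards [hψ2, hD2', hD] with σ h1 h2 h3
    refine ⟨h1, h2, fun χ hχ lam => ?_⟩
    have h𝔹 : ∀ i c l e, Torus.IsSmooth (fun y => Torus.Visc4.conj (G (t₀ - σ) y) (Torus.majorTranspose 𝔹₀) i c l e) :=
      fun i c l e => isSmooth_conj_field (hGs (t₀ - σ)) _ i c l e
    have hQ' : ∀ y (ξ : Fin 3 → Fin 3 → ℝ), 0 ≤ ∑ l, ∑ i, ∑ c, ∑ e,
        Torus.Visc4.conj (G (t₀ - σ) y) (Torus.majorTranspose 𝔹₀) i c l e * ξ c i * ξ e l :=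
      fun y ξ => (quadForm_conj_nonneg hQ (G (t₀ - σ) y) ξ).2
    have key := integral_quadForm_ge_duality_smul h𝔹 hQ' h1 h2 h3 hχ lam
    have e : (fun y => Torus.majorTranspose (Torus.Visc4.conj (G (t₀ - σ) y) (Torus.majorTranspose 𝔹₀)))
        = fun y => Torus.Visc4.conj (G (t₀ - σ) y) 𝔹₀ := by
      funext y
      rw [← Torus.Visc4.conj_majorTranspose, Torus.majorTranspose_majorTranspose]
    rw [e] at key
    exact key

/-! ## §4 The integrated consumer form -/

/-- Points of the slab `(0,T) × 𝕋³` have their time coordinate in `(0,T)`, a.e. -/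
private theorem ae_fst_mem_Ioo₇ (T : ℝ) :
    ∀ᵐ p : ℝ × UnitAddTorus (Fin 3) ∂(((volume : Measure ℝ).restrict (Ioo 0 T)).prod volume), p.1 ∈ Ioo 0 T :=
  (Measure.quasiMeasurePreserving_fst (μ := (volume : Measure ℝ).restrict (Ioo 0 T))
    (ν := (volume : Measure (UnitAddTorus (Fin 3))))).ae (ae_restrict_mem measurableSet_Ioo)

/-- **Integrability in time of a dissipation density** `σ ↦ ∫ Σ 𝔅(σ,x) (Dψ σ)(Dψ σ)` on `(0,T)`, for jointly continuous coefficients and a weak gradient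
which is `L²` on the slab (bounded coefficient × product of two slab-`L²` functions, then Fubini). -/
theorem integrableOn_dissipation {T : ℝ} {Dψ : ℝ → Fin 3 → VF} {𝔅 : ℝ → UnitAddTorus (Fin 3) → Torus.Visc4 (Fin 3)}
    (h𝔅c : ∀ i c l e, Continuous (uncurry fun σ y => 𝔅 σ y i c l e))
    (hM : ∀ c, MemLp (uncurry (Dψ · c)) 2 (((volume : Measure ℝ).restrict (Ioo 0 T)).prod volume)) :
    IntegrableOn (fun σ => ∫ x, ∑ l, ∑ i, ∑ c, ∑ e, 𝔅 σ x i c l e * (Dψ σ c x) i * (Dψ σ e x) l) (Ioo 0 T) volume := by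
  have hcomp : ∀ c i, MemLp (fun p : ℝ × UnitAddTorus (Fin 3) => (Dψ p.1 c p.2) i) 2
      (((volume : Measure ℝ).restrict (Ioo 0 T)).prod volume) := fun c i => (hM c).eval_piLp i
  have hF : Integrable (fun p : ℝ × UnitAddTorus (Fin 3) => ∑ l, ∑ i, ∑ c, ∑ e, 𝔅 p.1 p.2 i c l e * (Dψ p.1 c p.2) i * (Dψ p.1 e p.2) l)
      (((volume : Measure ℝ).restrict (Ioo 0 T)).prod volume) := by
    refine integrable_finsetSum _ fun l _ => integrable_finsetSum _ fun i _ => integrable_finsetSum _ fun c _ =>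
      integrable_finsetSum _ fun e _ => ?_
    obtain ⟨C, hC⟩ := Torus.exists_bound_of_continuous_uncurry (h𝔅c i c l e) 0 T
    have hp : Integrable (fun p : ℝ × UnitAddTorus (Fin 3) => (Dψ p.1 c p.2) i * (Dψ p.1 e p.2) l)
        (((volume : Measure ℝ).restrict (Ioo 0 T)).prod volume) := (hcomp c i).integrable_mul (hcomp e l)
    have hbd := hp.bdd_mul (h𝔅c i c l e).aestronglyMeasurable (c := C) (by
      filter_upwards [ae_fst_mem_Ioo₇ T] with p hp1
      exact hC p.1 (Ioo_subset_Icc_self hp1) p.2)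
    exact hbd.congr (Eventually.of_forall fun p => by simp only [uncurry]; ring)
  exact hF.integral_prod_left

/-- **Monotone bookkeeping of a final stretch**: if `q = 2∫_{(0,L]} D` with `D ≥ 0` a.e. and integrable on `(0,L)`, then for every `τ ≤ L` and every
`f` integrable on `(0,τ]` with `f ≤ D` a.e. on `(0,τ)`: `2∫_{(0,τ]} f ≤ q`. -/
theorem two_setIntegral_le_of_le_density {L τ q : ℝ} {D f : ℝ → ℝ} (hq : q = 2 * ∫ σ in Ioc 0 L, D σ)
    (hD0 : ∀ᵐ σ ∂(volume.restrict (Ioo 0 L)), 0 ≤ D σ) (hDi : IntegrableOn D (Ioo 0 L) volume) (hτ : τ ≤ L)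
    (hfi : IntegrableOn f (Ioc 0 τ) volume) (hf : ∀ᵐ σ ∂(volume.restrict (Ioo 0 τ)), f σ ≤ D σ) :
    2 * ∫ σ in Ioc 0 τ, f σ ≤ q := by
  have hDi' : IntegrableOn D (Ioc 0 L) volume := by rwa [integrableOn_Ioc_iff_integrableOn_Ioo]
  have hD0' : 0 ≤ᵐ[volume.restrict (Ioc 0 L)] D := by
    rw [← Measure.restrict_congr_set Ioo_ae_eq_Ioc]; exact hD0
  have hsub : Ioc 0 τ ⊆ Ioc 0 L := Ioc_subset_Ioc le_rfl hτ
  have h1 : ∫ σ in Ioc 0 τ, f σ ≤ ∫ σ in Ioc 0 τ, D σ := by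
    refine setIntegral_mono_ae_restrict hfi (hDi'.mono_set hsub) ?_
    rw [← Measure.restrict_congr_set Ioo_ae_eq_Ioc]; exact hf
  have h2 : ∫ σ in Ioc 0 τ, D σ ≤ ∫ σ in Ioc 0 L, D σ :=
    setIntegral_mono_set hDi' hD0' (Eventually.of_forall hsub)
  rw [hq]; linarith

/-- **(S2-adj) CONSUMER INTERFACE.**  Under `hEA : EnergyIdGAdj Tw 𝔹₀ b G U`, smooth frame slices, jointly continuous frame entries and full
nonnegativity of the quadratic form of `𝔹₀`: for `0 < t₀ ≤ Tw` and a `G(t₀)`-solenoidal `ζ` there is the adjoint witness `(ψ, Dψ)` with its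
dissipation density `D(σ) = ∫ Σ (𝔹₀ᵀ)^{G(t₀−σ)} (Dψ σ)(Dψ σ)` INTEGRABLE and a.e. NONNEGATIVE on `(0,t₀)`, the a.e. slice facts and the scaled duality
of `exists_witness_duality`, and the bookkeeping rule: for every base time `s ∈ [0,t₀)`, every final stretch `τ ≤ t₀ − s` and every `f`
integrable on `(0,τ]` with `f ≤ D` a.e. on `(0,τ)`,  `2∫_{(0,τ]} f ≤ lossAdj (U s t₀) ζ`. -/
theorem EnergyIdGAdj.exists_witness_lossAdj_ge (hEA : EnergyIdGAdj Tw 𝔹₀ b G U)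
    (hGs : ∀ t i j, Torus.IsSmooth (fun y => G t y i j)) (hGc : ∀ i j, Continuous (uncurry fun t y => G t y i j))
    (hQ : ∀ ξ : Fin 3 → Fin 3 → ℝ, 0 ≤ ∑ l, ∑ i, ∑ c, ∑ e, 𝔹₀ i c l e * ξ c i * ξ e l)
    {t₀ : ℝ} (ht₀ : 0 < t₀) (ht₀T : t₀ ≤ Tw) (ζ : V2) (hζ : Torus.IsWeaklyDivFree (Torus.distort (G t₀) ((ζ : V2) : VF))) :
    ∃ (ψ : ℝ → VF) (Dψ : ℝ → Fin 3 → VF),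
      Torus.IsWeakTensorPassiveVectorDistortedOn 0 t₀ (Torus.majorTranspose 𝔹₀) (revCarrier b t₀) (fun σ => G (t₀ - σ)) ((ζ : V2) : VF) ψ ∧
      (∀ c, MemLp (uncurry (Dψ · c)) 2 (((volume : Measure ℝ).restrict (Ioo 0 t₀)).prod volume)) ∧
      (∀ᵐ σ ∂(volume.restrict (Ioo 0 t₀)), ∀ c, Torus.HasWeakPartialDeriv c (ψ σ) (Dψ σ c)) ∧
      IntegrableOn (fun σ => ∫ x, ∑ l, ∑ i, ∑ c, ∑ e,
        Torus.Visc4.conj (G (t₀ - σ) x) (Torus.majorTranspose 𝔹₀) i c l e * (Dψ σ c x) i * (Dψ σ e x) l) (Ioo 0 t₀) volume ∧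
      (∀ᵐ σ ∂(volume.restrict (Ioo 0 t₀)), 0 ≤ ∫ x, ∑ l, ∑ i, ∑ c, ∑ e,
        Torus.Visc4.conj (G (t₀ - σ) x) (Torus.majorTranspose 𝔹₀) i c l e * (Dψ σ c x) i * (Dψ σ e x) l) ∧
      (∀ᵐ σ ∂(volume.restrict (Ioo 0 t₀)), MemLp (ψ σ) 2 volume ∧ (∀ c, MemLp (Dψ σ c) 2 volume) ∧
        ∀ χ : VF, Torus.IsSmooth χ → ∀ lam : ℝ,
          lam * (-(∫ x, ⟪ψ σ x, Torus.viscAdjVar (fun y => Torus.Visc4.conj (G (t₀ - σ) y) 𝔹₀) χ x⟫_ℝ)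
                  - ∫ x, ⟪ψ σ x, Torus.viscAdjVar (fun y => Torus.Visc4.conj (G (t₀ - σ) y) (Torus.majorTranspose 𝔹₀)) χ x⟫_ℝ)
              - lam ^ 2 * ∫ x, ∑ l, ∑ i, ∑ c, ∑ e, Torus.Visc4.conj (G (t₀ - σ) x) (Torus.majorTranspose 𝔹₀) i c l e
                  * (Torus.partialDeriv c χ x) i * (Torus.partialDeriv e χ x) l
            ≤ ∫ x, ∑ l, ∑ i, ∑ c, ∑ e,
                Torus.Visc4.conj (G (t₀ - σ) x) (Torus.majorTranspose 𝔹₀) i c l e * (Dψ σ c x) i * (Dψ σ e x) l) ∧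
      ∀ s ∈ Ico 0 t₀, ∀ τ : ℝ, τ ≤ t₀ - s → ∀ f : ℝ → ℝ, IntegrableOn f (Ioc 0 τ) volume →
        (∀ᵐ σ ∂(volume.restrict (Ioo 0 τ)), f σ ≤ ∫ x, ∑ l, ∑ i, ∑ c, ∑ e,
          Torus.Visc4.conj (G (t₀ - σ) x) (Torus.majorTranspose 𝔹₀) i c l e * (Dψ σ c x) i * (Dψ σ e x) l) →
        2 * ∫ σ in Ioc 0 τ, f σ ≤ lossAdj (U s t₀) ζ := by
  obtain ⟨ψ, Dψ, hcl, hM, hD, hE, hdual⟩ := hEA.exists_witness_duality hGs hQ ht₀ ht₀T ζ hζ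
  -- joint continuity of the reversed conjugated coefficient field
  have h𝔅c : ∀ i c l e, Continuous (uncurry fun σ y => Torus.Visc4.conj (G (t₀ - σ) y) (Torus.majorTranspose 𝔹₀) i c l e) := by
    intro i c l e
    have hGc' : ∀ i j, Continuous (uncurry fun σ y => G (t₀ - σ) y i j) := fun i j =>
      (hGc i j).comp ((continuous_const.sub continuous_fst).prodMk continuous_snd)
    exact Torus.continuous_uncurry_conj_entry hGc' _ i c l e
  have hDi := integrableOn_dissipation h𝔅c hM
  have hD0 : ∀ᵐ σ ∂(volume.restrict (Ioo 0 t₀)), 0 ≤ ∫ x, ∑ l, ∑ i, ∑ c, ∑ e,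
      Torus.Visc4.conj (G (t₀ - σ) x) (Torus.majorTranspose 𝔹₀) i c l e * (Dψ σ c x) i * (Dψ σ e x) l := by
    filter_upwards [hdual] with σ hσ
    have h := hσ.2.2 (fun _ => 0) (Torus.isSmooth_const _) 0
    simpa using h
  refine ⟨ψ, Dψ, hcl, hM, hD, hDi, hD0, hdual, fun s hs τ hτ f hfi hf => ?_⟩
  have hDi' : IntegrableOn (fun σ => ∫ x, ∑ l, ∑ i, ∑ c, ∑ e,
      Torus.Visc4.conj (G (t₀ - σ) x) (Torus.majorTranspose 𝔹₀) i c l e * (Dψ σ c x) i * (Dψ σ e x) l) (Ioo 0 (t₀ - s)) volume :=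
    hDi.mono_set (Ioo_subset_Ioo le_rfl (by linarith [hs.1]))
  have hD0' : ∀ᵐ σ ∂(volume.restrict (Ioo 0 (t₀ - s))), 0 ≤ ∫ x, ∑ l, ∑ i, ∑ c, ∑ e,
      Torus.Visc4.conj (G (t₀ - σ) x) (Torus.majorTranspose 𝔹₀) i c l e * (Dψ σ c x) i * (Dψ σ e x) l :=
    ae_restrict_of_ae_restrict_of_subset (Ioo_subset_Ioo le_rfl (by linarith [hs.1])) hD0
  exact two_setIntegral_le_of_le_density (hE s hs) hD0' hDi' hτ hfi hf

end Summit.AnomalousDissipation.AnomalousDissipation.Theorems.SolenoidalFractalHomogenisation.LagrangianStep.VmodDist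

end
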